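import Mathlib.Analysis.Convolution
import Mathlib.Analysis.Calculus.ContDiff.Convolution
import Mathlib.Analysis.Calculus.ContDiff.Operations
import HarnessLib

/-!
# The Dixmier–Malliavin factorization theorem on the real line:
# `C_c^∞(ℝ) = span (C_c^∞(ℝ) ∗ C_c^∞(ℝ))` — STATEMENT (named fact)

Topic `Literature/Analysis/Convolution`.  One named fact, no proof claimed; no definition besides it.

J. Dixmier, P. Malliavin, *Factorisations de fonctions et de vecteurs indéfiniment différentiables*,
Bull. Sci. Math. (2) **102** (1978), 305–330 [bib: `DixmierMalliavin1978`], §3, Théorème 3.1 (quoted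
first-hand from two secondary sources that restate it verbatim — M. Francis, *A Dixmier–Malliavin
theorem for Lie groupoids*, arXiv:2009.13760, Theorem 1 "(3.1 Théorème, [Dixmier–Malliavin])": "Let `G`
be a Lie group and form the smooth convolution algebra `C_c^∞(G)`.  Then, every `φ ∈ C_c^∞(G)` can be
expressed as `f₁ ∗ ψ₁ + … + f_N ∗ ψ_N` where `f_i, ψ_i ∈ C_c^∞(G)`.  Moreover, we can choose this
factorization such that, for every `i`, `supp(ψ_i) ⊂ supp(φ)` and `supp(f_i) ⊂ W`, where `W ⊂ G` is a
neighbourhood of the identity fixed in advance."; and D. Hegde, *Schwartz functions, Hadamard products,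
and the Dixmier–Malliavin theorem*, arXiv:2103.05495 [bib: `Hegde2021`], Theorem 18 with a complete
proof in §§3.1–3.3 — for `G = ℝ` the proof gives TWO summands, `φ = f ∗ Φ − h ∗ φ` with
`Φ = Σ_j (−1)^j b_j φ^{(2j)}` and `f, h ∈ C_c^∞(ℝ)` built from `ψ̂(ξ) = 1/Π_n (1 + ξ²/a_n²)`; the original
is requested, acq-11311).  The question goes back to L. Ehrenpreis (1960); for `ℝ` even a single
product suffices (R. Yulmukhametov 1999), which is NOT asserted here.

## What is typed

`DixmierMalliavin_real`: the first sentence of Théorème 3.1 for the Lie group `G = (ℝ, +)` and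
complex-valued test functions — every `φ : ℝ → ℂ` which is smooth (`ContDiff ℝ ∞`) with compact support is
a finite sum `Σ_{i<N} f_i ∗ ψ_i` of convolutions (Mathlib's `MeasureTheory.convolution` for the bilinear
map `ContinuousLinearMap.mul ℂ ℂ` and Lebesgue measure: `(f ∗ ψ)(x) = ∫ f(t) ψ(x − t) dt`, the Haar
convolution of the additive group `ℝ`) of smooth compactly supported `f_i, ψ_i : ℝ → ℂ`.
`-- TODO(general form): arbitrary real Lie groups `G`; the support refinement `supp ψ_i ⊆ supp φ`,
`supp f_i ⊆ W`; the companion Théorème 3.3 (smooth vectors of Fréchet representations).`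

First consumer: `Literature.NumberTheory.ConnesConsani2021.CC2021_thm_4_7_of_sec2_sec4_of_factorization`
(Connes–Consani 2021, Thm. 4.7 as printed: the trace `Tr(ϑ(f)𝐒)` along every orthonormal basis of
Sonin's space for EVERY test function `f`, reduced by polarization to autocorrelations `g ∗ g*` once `f`
is a finite sum of convolutions of test functions).  The two sanity lemmas below are PROVED: the span
of convolutions consists of test functions (the easy converse inclusion), so the fact says exactly that
the two classes coincide.
-/

noncomputable section

open MeasureTheory
open scoped ContDiff Convolution

namespace Literature.Analysis.Convolution

/-- **Dixmier–Malliavin factorization on the real line (NAMED FACT, no proof claimed).**  "Let `G` be a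
Lie group and form the smooth convolution algebra `C_c^∞(G)`.  Then every `φ ∈ C_c^∞(G)` can be
expressed as `f₁ ∗ ψ₁ + … + f_N ∗ ψ_N` where `f_i, ψ_i ∈ C_c^∞(G)`" — here for `G = (ℝ, +)` and
complex-valued functions: every smooth compactly supported `φ : ℝ → ℂ` is a finite sum of convolutions
`f_i ⋆ ψ_i = x ↦ ∫ f_i(t) ψ_i(x − t) dt` of smooth compactly supported `f_i, ψ_i : ℝ → ℂ`.
[cite: DixmierMalliavin1978, §3 Thm. 3.1 (pp. 305–330; quoted via Francis arXiv:2009.13760 Thm. 1 and Hegde2021 Thm. 18)] -/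
def DixmierMalliavin_real : Prop :=
  ∀ φ : ℝ → ℂ, ContDiff ℝ ∞ φ → HasCompactSupport φ →
    ∃ (N : ℕ) (f ψ : Fin N → ℝ → ℂ),
      (∀ i, ContDiff ℝ ∞ (f i) ∧ HasCompactSupport (f i)) ∧
      (∀ i, ContDiff ℝ ∞ (ψ i) ∧ HasCompactSupport (ψ i)) ∧
      φ = ∑ i, (f i ⋆[ContinuousLinearMap.mul ℂ ℂ, volume] ψ i)

/-- The easy inclusion (PROVED): a convolution of two smooth compactly supported functions on `ℝ` is
smooth and compactly supported (Mathlib: `HasCompactSupport.contDiff_convolution_right`,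
`HasCompactSupport.convolution`; "the convolution `f∗g` of two test functions on `G` is a test function").
[cite: Hegde2021, §1 p. 3 (Introduction, sentence after Theorem 1)] -/
theorem contDiff_and_hasCompactSupport_convolution {f ψ : ℝ → ℂ} (hf : ContDiff ℝ ∞ f)
    (hfc : HasCompactSupport f) (hψ : ContDiff ℝ ∞ ψ) (hψc : HasCompactSupport ψ) :
    ContDiff ℝ ∞ (f ⋆[ContinuousLinearMap.mul ℂ ℂ, volume] ψ) ∧
      HasCompactSupport (f ⋆[ContinuousLinearMap.mul ℂ ℂ, volume] ψ) := by
  -- Mathlib's smoothness lemma is stated over the base field of differentiation: rewrite the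
  -- `ℂ`-bilinear multiplication as the `ℝ`-bilinear one (same function).
  have e : (f ⋆[ContinuousLinearMap.mul ℂ ℂ, volume] ψ) = (f ⋆[ContinuousLinearMap.mul ℝ ℂ, volume] ψ) := by
    funext x; simp [convolution_def]
  rw [e]
  exact ⟨hψc.contDiff_convolution_right (ContinuousLinearMap.mul ℝ ℂ) hf.continuous.locallyIntegrable hψ,
    hfc.convolution (ContinuousLinearMap.mul ℝ ℂ) hψc⟩

/-- The easy inclusion for finite sums (PROVED): every finite sum of convolutions of smooth compactly
supported functions is smooth and compactly supported — so `DixmierMalliavin_real` states exactly that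
`C_c^∞(ℝ; ℂ)` EQUALS the linear span of `C_c^∞ ∗ C_c^∞` ("every test function on a Lie group is a finite
linear combination of convolutions of two test functions and … the convolution `f∗g` of two test
functions on `G` is a test function"). [cite: Hegde2021, §1 p. 3 (Introduction)] -/
theorem contDiff_and_hasCompactSupport_sum_convolution {N : ℕ} {f ψ : Fin N → ℝ → ℂ}
    (hf : ∀ i, ContDiff ℝ ∞ (f i) ∧ HasCompactSupport (f i))
    (hψ : ∀ i, ContDiff ℝ ∞ (ψ i) ∧ HasCompactSupport (ψ i)) :
    ContDiff ℝ ∞ (∑ i, (f i ⋆[ContinuousLinearMap.mul ℂ ℂ, volume] ψ i)) ∧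
      HasCompactSupport (∑ i, (f i ⋆[ContinuousLinearMap.mul ℂ ℂ, volume] ψ i)) := by
  refine ⟨?_, ?_⟩
  · rw [Finset.sum_fn]
    exact ContDiff.sum fun i _ =>
      (contDiff_and_hasCompactSupport_convolution (hf i).1 (hf i).2 (hψ i).1 (hψ i).2).1
  · have : ∀ s : Finset (Fin N),
        HasCompactSupport (∑ i ∈ s, (f i ⋆[ContinuousLinearMap.mul ℂ ℂ, volume] ψ i)) := by
      intro s
      classical
      induction s using Finset.induction_on with
      | empty => simpa using HasCompactSupport.zero
      | insert a s ha ih =>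
        rw [Finset.sum_insert ha]
        exact (contDiff_and_hasCompactSupport_convolution (hf a).1 (hf a).2 (hψ a).1 (hψ a).2).2.add
          ih
    exact this Finset.univ

end Literature.Analysis.Convolution

end
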